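import Literature.Dynamics.Billiards.InfiniteUnstablePlaques
import HarnessLib

/-!
# Teeth of the unstable-plaque functor of the infinite hard-sphere flow: frozen stationary
# states are not u-regular

Topic `Literature/Dynamics/Billiards`; companion of
`Literature.Dynamics.Billiards.InfiniteUnstablePlaques` (definition item
`defn-InfiniteUnstablePlaques`, route UGibbsSRBRigidity): the TEETH acceptance test
`PlaqueTeeth` is PROVED for the functor `infiniteUnstablePlaques`
(`plaqueTeeth_infiniteUnstablePlaques`): for `d ≥ 1`, every diameter `ε > 0` and every infinite
hard-sphere flow `Φ`, a nonzero finite law `μ` that is stationary under `Φ` and under which almost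
surely all particles share one velocity (a *frozen* state: no collisions, no expansion — the
infinite-volume version of the refuters' B1/B2 vacuity probes and of the ideal-gas kernel of
`Literature.Barriers.AtomisticToContinuum.BoltzmannHypothesisBarrier`) is NOT u-regular for
`infiniteUnstablePlaques ε Φ`. In particular u-regularity for this functor is not decided by the
choice of leaf measures: the zero-velocity translation-invariant Poisson-type hard-core states are
stationary, translation invariant, of any small density, and fail it.

## Proof (all steps proved here; no named facts)

1. `frozenSet`, `measurableSet_frozenSet`: the frozen configurations form a measurable set (its
   complement is a countable union of count events over pairs of disjoint basic open sets of
   velocities).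
2. **Rigidity of the window dynamics** `IsWindowTrajectory.eq_rigid_of_frozen`: a window
   trajectory (reversed time, one-sided law, `InfiniteUnstablePlaques` §2) whose window particles
   start with a common velocity `u` in an environment moving rigidly with velocity `u` moves
   rigidly with velocity `u`: a first contact time exists if any does (finitely many contacts in
   bounded times), the motion is rigid before it, so by continuity of positions the contact is
   already present at time `0`, where equal velocities make it grazing — excluded by the
   non-grazing clause.
3. `coe_subset_of_mem_windowUnstableSet_of_frozen`: if `ω` is frozen with straight recorded
   backward paths, a FROZEN member `implant Λ ω y` of a window unstable set of `ω` consists of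
   particles of `ω`: the kept exterior forces the implanted velocities to be those of `ω` (or the
   window is all of `ω`), rigidity applies, and exponential convergence of the rigid perturbed
   window to the rigid recorded window forces `y =` recorded data.
4. **Stationary ⇒ straight past** `ae_straight_of_isStationary_of_frozen`: stationarity makes
   `Φ_t ω` frozen for all rational `t` simultaneously almost surely; a recorded solution frozen at
   all rational times has no contact (`not_mem_collisionEvents_of_frozen`: incoming velocities are
   constant on a short interval before a contact — finitely many contacts per particle in bounded
   times — and equal at a rational instant there, hence grazing), so by free flight the backward
   paths are straight (`eq_straight_of_frozen`).
5. `plaqueTeeth_infiniteUnstablePlaques`: the frozen set has full `μ`-measure, and for `μ`-a.e.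
   `ω` its intersection with the plaque of `ω` lies in the configurations drawn from the countable
   set of particles of `ω`, which is leaf-null
   (`infiniteUnstablePlaques_leafMeasure_setOf_coe_subset_eq_zero`, Hausdorff dimension `dk > 0`);
   off the good set plaques are empty. Hence u-regularity would force `μ (frozenSet) = 0`, i.e.
   `μ = 0`.

Laminar (planar) and periodised finite-`N` states are NOT treated: their failure needs the
dimension theory of the window plaques (an upper bound `< dk` on the Hausdorff dimension of the
plaque inside the laminar slice), not only the definition; they are route items.

## References

* F. Ledrappier, L.-S. Young, Ann. Math. 122 (1985), (1.2), Def. 1.4.2 [LedrappierYoung1985].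
* R. Alexander, Comm. Math. Phys. 49 (1976), §4.2, 4.8 (a), Cor. 5.4 [Alexander1976].
-/

noncomputable section

open MeasureTheory Set Filter Metric Function Topology
open scoped ENNReal NNReal InnerProductSpace
open Literature.Analysis.FunctionSpaces Literature.Analysis.FluidPDE

namespace Literature.Dynamics.Billiards

section TeethFile

variable {d : Type*} [Fintype d]

local notation "𝔼" => EuclideanSpace ℝ d
local notation "𝕏" => EuclideanSpace ℝ d × EuclideanSpace ℝ d

/-! ## 1. Frozen configurations -/

omit [Fintype d] in
/-- The **frozen configurations**: all particles share one velocity (no collisions, no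
expansion under the hard-sphere dynamics). [folklore] -/
def frozenSet : Set (PointConfig 𝕏) :=
  {ω | ∀ p ∈ ω, ∀ q ∈ ω, p.2 = q.2}

omit [Fintype d] in
/-- Membership in the frozen set. [folklore] -/
theorem mem_frozenSet_iff {ω : PointConfig 𝕏} :
    ω ∈ frozenSet ↔ ∀ p ∈ ω, ∀ q ∈ ω, p.2 = q.2 :=
  Iff.rfl

omit [Fintype d] in
/-- A count is nonzero iff some particle lies in the set. [folklore] -/
theorem count_ne_zero_iff (ω : PointConfig 𝕏) (s : Set 𝕏) : ω.count s ≠ 0 ↔ ∃ p ∈ ω, p ∈ s := by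
  rw [PointConfig.count, encard_ne_zero]
  exact ⟨fun ⟨p, hp, hps⟩ => ⟨p, hp, hps⟩, fun ⟨p, hp, hps⟩ => ⟨p, hp, hps⟩⟩

/-- The complement of the frozen set is the countable union, over pairs of disjoint basic open
sets of velocity space, of the count events "a particle with velocity in each". [folklore] -/
theorem compl_frozenSet_eq :
    (frozenSet : Set (PointConfig 𝕏))ᶜ =
      ⋃ b ∈ {b : Set 𝔼 × Set 𝔼 | b.1 ∈ TopologicalSpace.countableBasis 𝔼 ∧
          b.2 ∈ TopologicalSpace.countableBasis 𝔼 ∧ Disjoint b.1 b.2},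
        {ω : PointConfig 𝕏 | ω.count (univ ×ˢ b.1) ≠ 0 ∧ ω.count (univ ×ˢ b.2) ≠ 0} := by
  have hB := TopologicalSpace.isBasis_countableBasis 𝔼
  ext ω
  simp only [mem_compl_iff, mem_frozenSet_iff, mem_iUnion, mem_setOf_eq, exists_prop,
    count_ne_zero_iff, mem_prod, mem_univ, true_and]
  constructor
  · intro h
    simp only [not_forall, exists_prop] at h
    obtain ⟨p, hp, q, hq, hpq⟩ := h
    obtain ⟨U, V, hU, hV, hpU, hqV, hUV⟩ := t2_separation hpq
    obtain ⟨B₁, hB₁, hpB₁, hB₁U⟩ := hB.exists_subset_of_mem_open hpU hU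
    obtain ⟨B₂, hB₂, hqB₂, hB₂V⟩ := hB.exists_subset_of_mem_open hqV hV
    exact ⟨(B₁, B₂), ⟨hB₁, hB₂, hUV.mono hB₁U hB₂V⟩, ⟨p, hp, hpB₁⟩, ⟨q, hq, hqB₂⟩⟩
  · rintro ⟨⟨B₁, B₂⟩, ⟨-, -, hdisj⟩, ⟨p, hp, hpB₁⟩, ⟨q, hq, hqB₂⟩⟩ h
    exact hdisj.ne_of_mem hpB₁ hqB₂ (h p hp q hq)

/-- The frozen set is measurable for the count σ-algebra. [folklore] -/
theorem measurableSet_frozenSet : MeasurableSet (frozenSet : Set (PointConfig 𝕏)) := by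
  have hB := TopologicalSpace.isBasis_countableBasis 𝔼
  refine MeasurableSet.of_compl ?_
  rw [compl_frozenSet_eq]
  refine MeasurableSet.biUnion ?_ fun b hb => ?_
  · exact ((TopologicalSpace.countable_countableBasis 𝔼).prod
      (TopologicalSpace.countable_countableBasis 𝔼)).mono fun b hb => Set.mem_prod.2 ⟨hb.1, hb.2.1⟩
  · have h1 : MeasurableSet ((univ : Set 𝔼) ×ˢ b.1) :=
      MeasurableSet.univ.prod (hB.isOpen hb.1).measurableSet
    have h2 : MeasurableSet ((univ : Set 𝔼) ×ˢ b.2) :=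
      MeasurableSet.univ.prod (hB.isOpen hb.2.1).measurableSet
    exact ((PointConfig.measurable_count h1 (measurableSet_singleton 0)).compl).inter
      ((PointConfig.measurable_count h2 (measurableSet_singleton 0)).compl)

/-! ## 2. Rigidity of the window dynamics started at rest relative to a rigid environment -/

omit [Fintype d] in
/-- Arithmetic of free back-extrapolation: if the state `a` at time `0` is the free
back-extrapolation of the state `b` at time `b₀` and has velocity `u`, then `b` is `a` moved
rigidly with velocity `u`. [folklore] -/
theorem eq_rigid_of_free_zero {a b : 𝕏} {u : 𝔼} {b₀ : ℝ}
    (key : a = (b.1 + (0 - b₀) • b.2, b.2)) (h0 : a.2 = u) : b = (a.1 + b₀ • u, u) := by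
  have hv : b.2 = u := by rw [← h0, key]
  refine Prod.ext ?_ hv
  rw [key, hv, zero_sub, neg_smul]
  simp

/-- A finite set of reals lying strictly below `τ` leaves a gap `(τ - η, τ)`, `0 < η ≤ 1`.
[folklore] -/
theorem exists_gap_below {A : Set ℝ} (hA : A.Finite) {τ : ℝ} (hlt : ∀ σ ∈ A, σ < τ) :
    ∃ η : ℝ, 0 < η ∧ η ≤ 1 ∧ ∀ σ ∈ A, σ ≤ τ - η := by
  by_cases hne : A.Nonempty
  · have hne' : hA.toFinset.Nonempty := by simpa using hne
    set m := hA.toFinset.max' hne' with hm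
    have hmA : m ∈ A := by simpa using hA.toFinset.max'_mem hne'
    have hmτ := hlt m hmA
    refine ⟨min 1 (τ - m), lt_min one_pos (sub_pos.2 hmτ), min_le_left _ _, fun σ hσ => ?_⟩
    have hσm : σ ≤ m := hA.toFinset.le_max' σ (by simpa using hσ)
    linarith [min_le_right 1 (τ - m)]
  · refine ⟨1, one_pos, le_rfl, fun σ hσ => ?_⟩
    exact absurd ⟨σ, hσ⟩ hne

variable {ε : ℝ}

/-- Window particles have finitely many contact times in `[0, b]`. [folklore] -/
theorem IsWindowTrajectory.finite_eventTimes {W : Finset 𝕏} {S : Set 𝕏} {z : 𝕏 → ℝ → 𝕏}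
    (hz : IsWindowTrajectory ε (W : Set 𝕏) S z) (b : ℝ) :
    {τ : ℝ | τ ∈ Icc 0 b ∧ ∃ p ∈ W, (p, τ) ∈ collisionEvents ε S z}.Finite := by
  refine ((hz.locFinite b).image Prod.snd).subset ?_
  rintro τ ⟨hτ, p, hp, hpτ⟩
  exact ⟨(p, τ), ⟨hpτ, Finset.mem_coe.2 hp, hτ⟩, rfl⟩

/-- **Rigidity of the window dynamics from frozen data**: if at time `0` every window particle
has the velocity `u` and every exterior particle moves rigidly with velocity `u` for all
`s ≥ 0`, then every window particle moves rigidly with velocity `u` for all `s ≥ 0` — there is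
no contact at all (a first contact would, by rigidity up to that instant and continuity of
positions, already be a contact at time `0`, which the non-grazing clause forbids for equal
velocities). [folklore] -/
theorem IsWindowTrajectory.eq_rigid_of_frozen {W : Finset 𝕏} {S : Set 𝕏} {z : 𝕏 → ℝ → 𝕏}
    (hz : IsWindowTrajectory ε (W : Set 𝕏) S z) (u : 𝔼)
    (h0 : ∀ p ∈ W, (z p 0).2 = u)
    (henv : ∀ q ∈ S, q ∉ W → ∀ s : ℝ, 0 ≤ s → z q s = ((z q 0).1 + s • u, u)) :
    ∀ p ∈ W, ∀ s : ℝ, 0 ≤ s → z p s = ((z p 0).1 + s • u, u) := by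
  -- contacts at time `0` are impossible: equal velocities are grazing
  have hno0 : ∀ p ∈ W, ∀ q ∈ S, p ≠ q → ‖(z p 0).1 - (z q 0).1‖ ≠ ε := by
    intro p hp q hq hpq hcontact
    have hvq : (z q 0).2 = u := by
      by_cases hqW : q ∈ W
      · exact h0 q hqW
      · have := henv q hq hqW 0 le_rfl
        rw [this]
    obtain ⟨-, hgraze, -⟩ := hz.collision p (Finset.mem_coe.2 hp) q hq hpq 0 le_rfl hcontact
    rw [h0 p hp, hvq, sub_self, inner_zero_right] at hgraze
    exact lt_irrefl _ hgraze
  -- Step 1: no window contact at any time `τ ≥ 0`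
  have hnoev : ∀ p ∈ W, ∀ τ : ℝ, 0 ≤ τ → (p, τ) ∉ collisionEvents ε S z := by
    intro p₀ hp₀ τ₀ hτ₀ hev₀
    set T : Set ℝ := {τ : ℝ | τ ∈ Icc 0 τ₀ ∧ ∃ p ∈ W, (p, τ) ∈ collisionEvents ε S z} with hT
    have hTfin : T.Finite := hz.finite_eventTimes τ₀
    have hτ₀T : τ₀ ∈ T := ⟨⟨hτ₀, le_rfl⟩, p₀, hp₀, hev₀⟩
    have hTne : hTfin.toFinset.Nonempty := ⟨τ₀, by simpa using hτ₀T⟩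
    set τ₁ : ℝ := hTfin.toFinset.min' hTne with hτ₁def
    have hτ₁T : τ₁ ∈ T := by simpa using hTfin.toFinset.min'_mem hTne
    have hmin : ∀ τ ∈ T, τ₁ ≤ τ := fun τ hτ => hTfin.toFinset.min'_le τ (by simpa using hτ)
    obtain ⟨⟨hτ₁0, hτ₁le⟩, p₁, hp₁, hev₁⟩ := hτ₁T
    -- no window contact in `[0, τ₁)`, hence rigid motion of the window particles there
    have hfree : ∀ p ∈ W, ∀ τ ∈ Ico 0 τ₁, (p, τ) ∉ collisionEvents ε S z := by
      intro p hp τ hτ hev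
      exact absurd (hmin τ ⟨⟨hτ.1, hτ.2.le.trans hτ₁le⟩, p, hp, hev⟩) (not_le.2 hτ.2)
    have hrig : ∀ p ∈ W, ∀ b ∈ Ico 0 τ₁, z p b = ((z p 0).1 + b • u, u) := by
      intro p hp b hb
      exact eq_rigid_of_free_zero (hz.free p (Finset.mem_coe.2 hp) 0 b le_rfl hb.1
        fun τ hτ => hfree p hp τ ⟨hτ.1, hτ.2.trans_le hb.2.le⟩) (h0 p hp)
    have hrigS : ∀ q ∈ S, ∀ b ∈ Ico 0 τ₁, z q b = ((z q 0).1 + b • u, u) := by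
      intro q hq b hb
      by_cases hqW : q ∈ W
      · exact hrig q hqW b hb
      · exact henv q hq hqW b hb.1
    -- the contact at `τ₁` is already a contact at time `0`
    obtain ⟨-, q₁, hq₁, hq₁p, hcontact⟩ := mem_collisionEvents.1 hev₁
    have hp₁S : p₁ ∈ S := (mem_collisionEvents.1 hev₁).1
    have hcontact0 : ‖(z p₁ 0).1 - (z q₁ 0).1‖ = ε := by
      rcases hτ₁0.eq_or_lt with h0eq | hpos
      · rw [h0eq]; exact hcontact
      · -- positions: continuous on `[0, ∞)`, difference constant on `[0, τ₁)`
        set f : ℝ → 𝔼 := fun s => (z p₁ s).1 - (z q₁ s).1 with hf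
        have hcontS : ∀ q ∈ S, ContinuousWithinAt (fun s => (z q s).1) (Ici 0) τ₁ := by
          intro q hq
          by_cases hqW : q ∈ W
          · exact hz.pos_continuous q (Finset.mem_coe.2 hqW) τ₁ hτ₁0
          · have heq : EqOn (fun s => (z q s).1) (fun s => (z q 0).1 + s • u) (Ici 0) :=
              fun s hs => by
                show (z q s).1 = (z q 0).1 + s • u
                rw [henv q hq hqW s hs]
            exact (ContinuousWithinAt.congr ((continuous_const.add
              (continuous_id.smul continuous_const)).continuousWithinAt) heq
              (heq hτ₁0))
        have hfcont : ContinuousWithinAt f (Ico 0 τ₁) τ₁ :=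
          ((hcontS p₁ hp₁S).sub (hcontS q₁ hq₁)).mono Ico_subset_Ici_self
        have hfconst : ∀ s ∈ Ico 0 τ₁, f s = f 0 := by
          intro s hs
          simp only [hf]
          rw [hrigS p₁ hp₁S s hs, hrigS q₁ hq₁ s hs]
          exact add_sub_add_right_eq_sub _ _ _
        have hτ₁cl : τ₁ ∈ closure (Ico 0 τ₁) := by
          rw [closure_Ico hpos.ne]
          exact ⟨hpos.le, le_rfl⟩
        have himg : f '' Ico 0 τ₁ ⊆ {f 0} := by
          rintro _ ⟨s, hs, rfl⟩
          exact hfconst s hs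
        have hfeq : f τ₁ = f 0 := by
          have h := closure_mono himg (hfcont.mem_closure_image hτ₁cl)
          rwa [closure_singleton, mem_singleton_iff] at h
        show ‖f 0‖ = ε
        rw [← hfeq]
        exact hcontact
    exact hno0 p₁ hp₁ q₁ hq₁ (Ne.symm hq₁p) hcontact0
  -- Step 2: no contacts, hence free rigid flight from the time-`0` data
  intro p hp s hs
  exact eq_rigid_of_free_zero
    (hz.free p (Finset.mem_coe.2 hp) 0 s le_rfl hs fun τ hτ => hnoev p hp τ hτ.1) (h0 p hp)

/-! ## 3. Frozen members of the window plaques of a frozen configuration with straight past -/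

/-- **Frozen plaque members of a frozen configuration with straight recorded past are made of
its own particles.** If `ω` is frozen and its recorded backward paths are straight, then every
FROZEN configuration in a window unstable set of `ω` consists of particles of `ω` (indeed the
perturbed window particles must equal the recorded ones): by rigidity of the window dynamics the
perturbed window moves rigidly, and exponential convergence to the recorded (rigidly moving)
window forces equality of the time-`0` data. [folklore] -/
theorem coe_subset_of_mem_windowUnstableSet_of_frozen {Φ : InfiniteHardSphereFlow d ε}
    {Λ : Set 𝔼} {ω ω' : PointConfig 𝕏} (hfin : (particlesIn ω Λ).Finite)
    (hstraight : ∀ p ∈ ω, ∀ t : ℝ, t ≤ 0 → Φ.traj ω p t = (p.1 + t • p.2, p.2))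
    (hω' : ω' ∈ windowUnstableSet Φ Λ ω) (hω'F : ω' ∈ frozenSet) : (ω' : Set 𝕏) ⊆ ω := by
  obtain ⟨hω, x, hz, ⟨r, hr, hconv⟩, rfl⟩ := hω'
  set L : Finset 𝕏 := windowLabels Λ ω with hL
  -- it suffices that every implanted phase point is the recorded one
  suffices hy : ∀ p : ↥L, revPhase (x p 0) = (p : 𝕏) by
    rw [coe_implant]
    refine union_subset inter_subset_left ?_
    rintro _ ⟨p, rfl⟩
    show revPhase (x p 0) ∈ (ω : Set 𝕏)
    rw [hy p]
    exact windowLabels_subset Λ ω p.2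
  by_cases hLne : L.Nonempty
  swap
  · intro p
    exact absurd ⟨(p : 𝕏), p.2⟩ hLne
  obtain ⟨p₀, hp₀⟩ := hLne
  have hLω : ∀ p ∈ L, p ∈ ω := fun p hp => windowLabels_subset Λ ω (Finset.mem_coe.2 hp)
  -- the implanted points and the kept exterior are particles of the frozen `ω'`
  have hmemy : ∀ p ∈ L, revPhase (x p 0) ∈ implant Λ ω (fun p : ↥L => revPhase (x p 0)) :=
    fun p hp => (mem_implant_iff Λ ω _).2 (Or.inr ⟨⟨p, hp⟩, rfl⟩)
  set u : 𝔼 := (x p₀ 0).2 with hu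
  have hyu : ∀ p ∈ L, (x p 0).2 = u := by
    intro p hp
    have h := hω'F _ (hmemy p hp) _ (hmemy p₀ hp₀)
    simpa only [revPhase_snd, neg_inj] using h
  -- window data at time `0` of the glued family
  have h0 : ∀ p ∈ L, (gluePaths (L : Set 𝕏) x (revTraj Φ ω) p 0).2 = u := by
    intro p hp
    rw [gluePaths_of_mem x _ (Finset.mem_coe.2 hp)]
    exact hyu p hp
  -- exterior particles: kept in `ω'`, hence of velocity `-u`, and moving rigidly (straight past)
  have henv : ∀ q ∈ (ω : Set 𝕏), q ∉ L → ∀ s : ℝ, 0 ≤ s →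
      gluePaths (L : Set 𝕏) x (revTraj Φ ω) q s =
        ((gluePaths (L : Set 𝕏) x (revTraj Φ ω) q 0).1 + s • u, u) := by
    intro q hq hqL s hs
    have hqΛ : q.1 ∉ Λ := fun h => hqL ((mem_windowLabels_iff hfin).2 ⟨hq, h⟩)
    have hqω' : q ∈ implant Λ ω (fun p : ↥L => revPhase (x p 0)) :=
      (mem_implant_iff Λ ω _).2 (Or.inl ⟨hq, hqΛ⟩)
    have hqu : q.2 = -u := by
      have h := hω'F _ hqω' _ (hmemy p₀ hp₀)
      simpa only [revPhase_snd] using h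
    have hqL' : q ∉ (L : Set 𝕏) := fun h => hqL (Finset.mem_coe.1 h)
    rw [gluePaths_of_notMem x _ hqL', revTraj_apply, revTraj_apply, neg_zero,
      hstraight q hq (-s) (by linarith), hstraight q hq 0 le_rfl, hqu]
    simp [revPhase]
  -- rigidity of the window dynamics
  have hrig := hz.eq_rigid_of_frozen u h0 henv
  -- convergence to the recorded (rigid) window paths forces equality of the data
  have hlim : Tendsto (fun s : ℝ => Real.exp (-(r * s))) atTop (𝓝 0) :=
    Real.tendsto_exp_neg_atTop_nhds_zero.comp (tendsto_id.const_mul_atTop hr)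
  intro p
  have hp : (p : 𝕏) ∈ L := p.2
  have hxp : ∀ s : ℝ, 0 ≤ s → x p s = ((x p 0).1 + s • u, u) := by
    intro s hs
    have h := hrig p hp s hs
    rwa [gluePaths_of_mem x _ (Finset.mem_coe.2 hp)] at h
  have hrec : ∀ s : ℝ, 0 ≤ s → revTraj Φ ω p s = ((p : 𝕏).1 - s • (p : 𝕏).2, -(p : 𝕏).2) := by
    intro s hs
    rw [revTraj_apply, hstraight p (hLω p hp) (-s) (by linarith)]
    simp [revPhase, sub_eq_add_neg]
  have hev : ∀ᶠ s : ℝ in atTop, dist ((x p 0).1 + s • u, u) ((p : 𝕏).1 - s • (p : 𝕏).2, -(p : 𝕏).2)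
      ≤ Real.exp (-(r * s)) := by
    filter_upwards [hconv, eventually_ge_atTop 0] with s hs hs0
    rw [← hxp s hs0, ← hrec s hs0]
    exact hs p hp
  have hdist1 : ∀ a b : 𝕏, dist a.1 b.1 ≤ dist a b := fun a b => by
    rw [Prod.dist_eq]; exact le_max_left _ _
  have hdist2 : ∀ a b : 𝕏, dist a.2 b.2 ≤ dist a b := fun a b => by
    rw [Prod.dist_eq]; exact le_max_right _ _
  -- velocities agree
  have hvel : u = -(p : 𝕏).2 := by
    have h : dist u (-(p : 𝕏).2) ≤ 0 := by
      refine ge_of_tendsto hlim (hev.mono fun s hs => ?_)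
      have h2 := hdist2 ((x p 0).1 + s • u, u) ((p : 𝕏).1 - s • (p : 𝕏).2, -(p : 𝕏).2)
      exact le_trans h2 hs
    exact dist_le_zero.1 h
  -- positions agree
  have hpos : (x p 0).1 = (p : 𝕏).1 := by
    have h : dist (x p 0).1 (p : 𝕏).1 ≤ 0 := by
      refine ge_of_tendsto hlim (hev.mono fun s hs => ?_)
      have h1 := le_trans
        (hdist1 ((x p 0).1 + s • u, u) ((p : 𝕏).1 - s • (p : 𝕏).2, -(p : 𝕏).2)) hs
      have h1' : dist ((x p 0).1 + s • u) ((p : 𝕏).1 - s • (p : 𝕏).2) ≤ Real.exp (-(r * s)) := h1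
      rwa [show (p : 𝕏).1 - s • (p : 𝕏).2 = (p : 𝕏).1 + s • u by
        rw [hvel, smul_neg, sub_eq_add_neg], dist_add_right] at h1'
    exact dist_le_zero.1 h
  simp only [revPhase, hpos, hyu p hp, hvel, neg_neg, Prod.mk.eta]

/-! ## 4. Stationary frozen laws: straight recorded past almost surely -/

/-- Each particle of a solution of the infinite equations of motion has finitely many contact
times in a bounded time interval (its position being bounded there). [folklore] -/
theorem finite_eventTimes_of_isInfiniteHardSphereTrajectory {S : Set 𝕏} {x : 𝕏 → ℝ → 𝕏}
    (hx : IsInfiniteHardSphereTrajectory ε S x) {p : 𝕏} (hp : p ∈ S) (a b : ℝ) :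
    {σ : ℝ | σ ∈ Icc a b ∧ (p, σ) ∈ collisionEvents ε S x}.Finite := by
  obtain ⟨r, hr⟩ := isCompact_Icc.exists_bound_of_continuousOn
    ((hx.pos_continuous p hp).continuousOn (s := Icc a b))
  refine ((hx.locFinite r a b).image Prod.snd).subset ?_
  rintro σ ⟨hσ, hev⟩
  exact ⟨(p, σ), ⟨hev, hr σ hσ, hσ⟩, rfl⟩

/-- On a short interval before any instant a particle has no contact, so its velocity is
constant there and equals its incoming (left-limit) velocity. [folklore] -/
theorem exists_const_vel_before {S : Set 𝕏} {x : 𝕏 → ℝ → 𝕏}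
    (hx : IsInfiniteHardSphereTrajectory ε S x) {p : 𝕏} (hp : p ∈ S) (τ : ℝ) :
    ∃ η : ℝ, 0 < η ∧ ∀ σ ∈ Ico (τ - η) τ, (x p σ).2 = (x p (τ - η)).2 := by
  -- a gap below `τ` free of contacts of `p`
  have hfin := finite_eventTimes_of_isInfiniteHardSphereTrajectory hx hp (τ - 1) τ
  obtain ⟨η, hη, hη1, hgap⟩ := exists_gap_below
    (hfin.subset (fun σ (hσ : σ ∈ {σ | σ ∈ Icc (τ - 1) τ ∧ (p, σ) ∈ collisionEvents ε S x} ∩ Iio τ)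
      => hσ.1)) (fun σ hσ => hσ.2)
  refine ⟨η, hη, fun σ hσ => ?_⟩
  have key := hx.free p hp (τ - η) σ hσ.1 fun σ' hσ' hev => ?_
  · rw [key]
  · have hσ'τ : σ' < τ := hσ'.2.trans_lt hσ.2
    have := hgap σ' ⟨⟨⟨by linarith [hσ'.1], hσ'τ.le⟩, hev⟩, hσ'τ⟩
    linarith [hσ'.1]

/-- **A solution frozen at all rational times has no contacts**: an incoming pair at a contact
instant has equal velocities just before (constant velocities on a short interval, evaluated at
a rational time), hence is grazing — excluded. [folklore] -/
theorem not_mem_collisionEvents_of_frozen {S : Set 𝕏} {x : 𝕏 → ℝ → 𝕏}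
    (hx : IsInfiniteHardSphereTrajectory ε S x)
    (hfro : ∀ t : ℚ, ∀ p ∈ S, ∀ q ∈ S, (x p t).2 = (x q t).2) {p : 𝕏} (hp : p ∈ S) (τ : ℝ) :
    (p, τ) ∉ collisionEvents ε S x := by
  intro hev
  obtain ⟨-, q, hq, hqp, hcontact⟩ := mem_collisionEvents.1 hev
  obtain ⟨-, vp, vq, hvp, hvq, hgraze, -⟩ := hx.binary p hp q hq (Ne.symm hqp) τ hcontact
  obtain ⟨η₁, hη₁, hp1⟩ := exists_const_vel_before hx hp τ
  obtain ⟨η₂, hη₂, hq1⟩ := exists_const_vel_before hx hq τ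
  set σ₀ : ℝ := τ - min η₁ η₂ with hσ₀
  have hσ₀τ : σ₀ < τ := by rw [hσ₀]; linarith [lt_min hη₁ hη₂]
  have hpconst : ∀ σ ∈ Ico σ₀ τ, (x p σ).2 = (x p (τ - η₁)).2 := fun σ hσ =>
    hp1 σ ⟨by linarith [hσ.1, min_le_left η₁ η₂], hσ.2⟩
  have hqconst : ∀ σ ∈ Ico σ₀ τ, (x q σ).2 = (x q (τ - η₂)).2 := fun σ hσ =>
    hq1 σ ⟨by linarith [hσ.1, min_le_right η₁ η₂], hσ.2⟩
  -- the left limits are these constants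
  have hmem : Ico σ₀ τ ∈ 𝓝[<] τ := Ico_mem_nhdsLT hσ₀τ
  have hvp' : vp = (x p (τ - η₁)).2 :=
    tendsto_nhds_unique hvp (tendsto_const_nhds.congr'
      (eventuallyEq_of_mem hmem fun σ hσ => (hpconst σ hσ).symm))
  have hvq' : vq = (x q (τ - η₂)).2 :=
    tendsto_nhds_unique hvq (tendsto_const_nhds.congr'
      (eventuallyEq_of_mem hmem fun σ hσ => (hqconst σ hσ).symm))
  -- evaluate at a rational time in the gap
  obtain ⟨t, hσ₀t, htτ⟩ := exists_rat_btwn hσ₀τ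
  have hpt := hpconst t ⟨hσ₀t.le, htτ⟩
  have hqt := hqconst t ⟨hσ₀t.le, htτ⟩
  have heq : vp = vq := by rw [hvp', hvq', ← hpt, ← hqt, hfro t p hp q hq]
  rw [heq, sub_self, inner_zero_right] at hgraze
  exact lt_irrefl _ hgraze

/-- **Frozen at all rational times ⇒ straight backward paths**: no contacts, hence free flight
back from the time-`0` data. [folklore] -/
theorem eq_straight_of_frozen {S : Set 𝕏} {x : 𝕏 → ℝ → 𝕏}
    (hx : IsInfiniteHardSphereTrajectory ε S x)
    (hfro : ∀ t : ℚ, ∀ p ∈ S, ∀ q ∈ S, (x p t).2 = (x q t).2)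
    (h0 : ∀ p ∈ S, x p 0 = p) {p : 𝕏} (hp : p ∈ S) {t : ℝ} (ht : t ≤ 0) :
    x p t = (p.1 + t • p.2, p.2) := by
  have key := hx.free p hp t 0 ht fun τ _ => not_mem_collisionEvents_of_frozen hx hfro hp τ
  rw [h0 p hp] at key
  -- key : p = ((x p t).1 + (0 - t) • (x p t).2, (x p t).2)
  have hv : (x p t).2 = p.2 := by
    have := congrArg Prod.snd key
    exact this.symm
  refine Prod.ext ?_ hv
  have h1 : p.1 = (x p t).1 + (0 - t) • (x p t).2 := congrArg Prod.fst key
  rw [hv] at h1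
  rw [h1, zero_sub, neg_smul]
  simp

/-- **Stationary frozen laws have straight recorded pasts almost surely**: if `μ` is
stationary under `Φ` and `μ`-a.e. configuration is frozen, then for `μ`-a.e. good `ω` every
recorded path is the free flight `t ↦ (q + t v, v)` for `t ≤ 0`. (Stationarity makes the evolved
configuration frozen at every rational time, almost surely and simultaneously.) [folklore] -/
theorem ae_straight_of_isStationary_of_frozen (Φ : InfiniteHardSphereFlow d ε)
    {μ : Measure (PointConfig 𝕏)} (hst : Φ.IsStationary μ) (hF : ∀ᵐ ω ∂μ, ω ∈ frozenSet) :
    ∀ᵐ ω ∂μ, ω ∈ Φ.good → ∀ p ∈ ω, ∀ t : ℝ, t ≤ 0 → Φ.traj ω p t = (p.1 + t • p.2, p.2) := by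
  have hFc : μ (frozenSet : Set (PointConfig 𝕏))ᶜ = 0 :=
    measure_eq_zero_iff_ae_notMem.2 (hF.mono fun ω hω h => h hω)
  have h1 : ∀ t : ℚ, ∀ᵐ ω ∂μ, Φ.flow t ω ∈ frozenSet := by
    intro t
    have h : μ ((Φ.flow t) ⁻¹' (frozenSet : Set (PointConfig 𝕏))ᶜ) = 0 := by
      rw [← Measure.map_apply (Φ.measurable_flow t) measurableSet_frozenSet.compl, hst t]
      exact hFc
    exact (measure_eq_zero_iff_ae_notMem.1 h).mono fun ω hω => not_not.1 hω
  rw [← ae_all_iff] at h1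
  filter_upwards [h1] with ω hω hgood p hp t ht
  have hfro : ∀ t : ℚ, ∀ a ∈ (ω : Set 𝕏), ∀ b ∈ (ω : Set 𝕏),
      (Φ.traj ω a t).2 = (Φ.traj ω b t).2 := fun t a ha b hb =>
    hω t _ (Φ.traj_mem_flow hgood ha t) _ (Φ.traj_mem_flow hgood hb t)
  exact eq_straight_of_frozen (Φ.isTrajectory ω hgood) hfro (fun q hq => Φ.traj_zero ω hgood q hq)
    hp ht

/-! ## 5. Teeth: frozen stationary states are not u-regular -/

/-- **Frozen plaque sections of the functor are leaf-null** at a good frozen configuration with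
straight recorded past (`ε > 0`, `d ≥ 1`). [folklore] -/
theorem leafMeasure_frozenSet_inter_plaque_eq_zero [Nonempty d] (hε : 0 < ε)
    (Φ : InfiniteHardSphereFlow d ε) {ω : PointConfig 𝕏} (hω : ω ∈ Φ.good)
    (hstraight : ∀ p ∈ ω, ∀ t : ℝ, t ≤ 0 → Φ.traj ω p t = (p.1 + t • p.2, p.2)) :
    (infiniteUnstablePlaques ε Φ).leafMeasure ω
      (frozenSet ∩ (infiniteUnstablePlaques ε Φ).plaque ω) = 0 := by
  refine measure_mono_null ?_ (infiniteUnstablePlaques_leafMeasure_setOf_coe_subset_eq_zero Φ ω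
    (countable_coe_pointConfig ω))
  rintro ω' ⟨hω'F, hω'W⟩
  rw [infiniteUnstablePlaques_plaque, mem_iUnion] at hω'W
  obtain ⟨n, hn⟩ := hω'W
  exact coe_subset_of_mem_windowUnstableSet_of_frozen
    (((Φ.good_subset hω).posLocallyFinite hε).finite_particlesIn isBounded_closedBall) hstraight
    hn hω'F

/-- **TEETH (frozen states)**: for `d ≥ 1`, the plaque functor `infiniteUnstablePlaques` passes the
frozen-state teeth test `PlaqueTeeth`: under any infinite hard-sphere flow with `ε > 0`, a nonzero
finite stationary law almost all of whose configurations are frozen (all particles with one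
velocity) is NOT u-regular — the frozen set has full measure but leaf-null plaque sections almost
everywhere (no expansion: the frozen members of the plaques of a frozen configuration consist of
its own particles, a leaf-null event since leaf measures have positive Hausdorff dimension).
[folklore] -/
theorem plaqueTeeth_infiniteUnstablePlaques [Nonempty d] :
    PlaqueTeeth (infiniteUnstablePlaques (d := d)) := by
  intro ε hε Φ μ hfin hμ0 hst hF hU
  have hF' : ∀ᵐ ω ∂μ, ω ∈ (frozenSet : Set (PointConfig 𝕏)) := hF
  have key : ∀ᵐ ω ∂μ, (infiniteUnstablePlaques ε Φ).leafMeasure ω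
      (frozenSet ∩ (infiniteUnstablePlaques ε Φ).plaque ω) = 0 := by
    filter_upwards [ae_straight_of_isStationary_of_frozen Φ hst hF'] with ω hω
    by_cases hgood : ω ∈ Φ.good
    · exact leafMeasure_frozenSet_inter_plaque_eq_zero hε Φ hgood (hω hgood)
    · rw [infiniteUnstablePlaques_leafMeasure_eq_zero Φ hgood, Measure.coe_zero, Pi.zero_apply]
  have hμF : μ frozenSet = 0 := hU _ measurableSet_frozenSet key
  have hμFc : μ (frozenSet : Set (PointConfig 𝕏))ᶜ = 0 :=
    measure_eq_zero_iff_ae_notMem.2 (hF'.mono fun ω hω h => h hω)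
  apply hμ0
  rw [← Measure.measure_univ_eq_zero, ← union_compl_self (frozenSet : Set (PointConfig 𝕏))]
  exact measure_union_null hμF hμFc

/-- **Frozen stationary states are not u-regular** (unpacked form of
`plaqueTeeth_infiniteUnstablePlaques`). [folklore] -/
theorem not_isURegular_infiniteUnstablePlaques_of_frozen [Nonempty d] (hε : 0 < ε)
    (Φ : InfiniteHardSphereFlow d ε) (μ : Measure (PointConfig 𝕏)) [IsFiniteMeasure μ]
    (hμ : μ ≠ 0) (hst : Φ.IsStationary μ) (hF : ∀ᵐ ω ∂μ, ∀ p ∈ ω, ∀ q ∈ ω, p.2 = q.2) :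
    ¬ (infiniteUnstablePlaques ε Φ).IsURegular μ :=
  plaqueTeeth_infiniteUnstablePlaques ε hε Φ μ ‹_› hμ hst hF

end TeethFile

end Literature.Dynamics.Billiards
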